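import Summits.MatrixMultiplication.OmegaCensus.STPP222GLNormalFormMaps
import HarnessLib

/-!
# (2,2,2)^k STPP families in (ℤ/p)³: the 'gl' NORMAL FORM of the SAT encodings is WITHOUT LOSS OF GENERALITY (kernel)

Cell `pub-omega` (unit `pub-omega-eng1-g29`, ENG1), topic `Summits/MatrixMultiplication/OmegaCensus`.
Framing (verbatim): lottery ticket; floor = certified bounds/negative ranges. HONEST FRAMING: elementary (translations, three explicit elements of
`GL₃(𝔽_p)`, a sorting permutation); its point is SOUNDNESS OF SYMMETRY BREAKING for the census cell P-041 («does (ℤ/5)³ host a (2,2,2)⁶ STPP family?»):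
the SAT attacks (stpp-3 `stppcnf.py --symx`, ENG1 `enc2.py --sym gl`) search only families in a normal form, and an UNSAT verdict means 'no family at all'
exactly if every family can be brought INTO the normal form by STPP-preserving symmetries — "the one place an UNSAT could be manufactured" (lead g31,
L32-9). This file proves that for ENG1's normal form (`GLNormalForm`, = the constraint set of `enc2.py --sym gl` read on sets): for every STPP family of
`k+1` triples of 2-sets in `V = ℤ/p × ℤ/p × ℤ/p` there is an STPP family of `k+1` triples of 2-sets IN NORMAL FORM (`exists_glNormalForm`). Symmetries used,
all tree theorems: per-member translations `IsSTPP.translate`, global `B`/`C` shifts `IsSTPP.shiftBC`, automorphisms `IsSTPP.map_addEquiv`, re-indexing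
`IsSTPP.comp_of_injective`. NORMAL FORM (e₁ = (0,0,1), e₂ = (0,1,0), e₃ = (1,0,0); `line` = multiples of e₁, `plane` = {x : x.1 = 0}):
(N1) `0 ∈ A i` for all `i`; (N2) `0 ∈ B 0`, `0 ∈ C 0`; (N3) `A 0 = {0, e₁}`; (N4) `B 0 = {0, b}` with `b ∈ line ∨ b = e₂`; (N5) `C 0 = {0, c}` with
`(b ∈ line ∧ (c ∈ line ∨ c = e₂)) ∨ (b = e₂ ∧ (c ∈ plane ∨ c = e₃))`; (N6) for `i ≠ 0`: `A i = {0, q i}` with `code (q i) ≤ code (−q i)`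
(`code x = x.1·p² + x.2.1·p + x.2.2` on representatives `0 … p−1` = the encoders' element codes); (N7) `code ∘ q` monotone on the indices `1 … k`.
(That `b, c, q i ≠ 0` is the cardinality-2 condition, kept separately.) Nothing here decides P-041 and nothing is a bound on `ω`.
-/

namespace Summit.MatrixMultiplication.OmegaCensus

open Finset Literature.Computability.AlgebraicComplexity

namespace GLNF

variable {p : ℕ} [Fact p.Prime]


section NormalForm

variable {k : ℕ}

/-- All three sets of every triple have exactly two elements (the pattern `(2,2,2)^{k+1}`). -/
def Cards2 (A B C : Fin (k + 1) → Finset (V p)) : Prop :=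
  ∀ i, (A i).card = 2 ∧ (B i).card = 2 ∧ (C i).card = 2

/-- **The 'gl' normal form** (= the constraint set of ENG1's `enc2.py --sym gl`, read on sets; see the module docstring for (N1)–(N7)). -/
def GLNormalForm (A B C : Fin (k + 1) → Finset (V p)) : Prop :=
  (∀ i, (0 : V p) ∈ A i) ∧ (0 : V p) ∈ B 0 ∧ (0 : V p) ∈ C 0 ∧
  A 0 = {0, e1} ∧
  (∃ b c : V p, B 0 = {0, b} ∧ C 0 = {0, c} ∧
    ((InLine b ∧ (InLine c ∨ c = e2)) ∨ (b = e2 ∧ (InPlane c ∨ c = e3)))) ∧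
  (∃ q : Fin (k + 1) → V p, (∀ i, i ≠ 0 → A i = {0, q i} ∧ code (q i) ≤ code (-(q i))) ∧
    ∀ i j : Fin (k + 1), i ≠ 0 → i ≤ j → code (q i) ≤ code (q j))

omit [Fact p.Prime] in
/-- A two-element set containing `x` is `{x, y}` for some `y ≠ x`. -/
theorem eq_pair_of_card_two {s : Finset (V p)} (hs : s.card = 2) {x : V p} (hx : x ∈ s) :
    ∃ y, y ≠ x ∧ s = {x, y} := by
  obtain ⟨u, v, huv, rfl⟩ := Finset.card_eq_two.1 hs
  simp only [Finset.mem_insert, Finset.mem_singleton] at hx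
  rcases hx with rfl | rfl
  · exact ⟨v, huv.symm, rfl⟩
  · exact ⟨u, huv, Finset.pair_comm u x⟩

/-- Translating a set keeps its cardinality. -/
theorem card_image_add_right (s : Finset (V p)) (t : V p) : (s.image (· + t)).card = s.card :=
  Finset.card_image_of_injective s (add_left_injective t)

/-- An automorphism keeps cardinalities. -/
theorem card_image_addEquiv (s : Finset (V p)) (φ : V p ≃+ V p) : (s.image φ).card = s.card :=
  Finset.card_image_of_injective s φ.injective

omit [Fact p.Prime] in
/-- The image of a pair `{x, y}`. -/
theorem image_pair (f : V p → V p) (x y : V p) : ({x, y} : Finset (V p)).image f = {f x, f y} := by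
  rw [Finset.image_insert, Finset.image_singleton]

/-- **Stage 1 (translations):** `0 ∈ A i` for all `i`, `0 ∈ B 0`, `0 ∈ C 0` — by `IsSTPP.translate` and `IsSTPP.shiftBC`. -/
theorem stage1 {A B C : Fin (k + 1) → Finset (V p)} (hS : IsSTPP A B C) (hc : Cards2 A B C) :
    ∃ A₁ B₁ C₁ : Fin (k + 1) → Finset (V p), IsSTPP A₁ B₁ C₁ ∧ Cards2 A₁ B₁ C₁ ∧
      (∀ i, (0 : V p) ∈ A₁ i) ∧ (0 : V p) ∈ B₁ 0 ∧ (0 : V p) ∈ C₁ 0 := by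
  classical
  -- a chosen element of each A i
  have hne : ∀ i, (A i).Nonempty := fun i => Finset.card_pos.1 (by rw [(hc i).1]; norm_num)
  let a : Fin (k + 1) → V p := fun i => (hne i).choose
  have ha : ∀ i, a i ∈ A i := fun i => (hne i).choose_spec
  let t : Fin (k + 1) → V p := fun i => -a i
  have hS' := hS.translate t
  -- B 0 and C 0 after the member translations are nonempty
  have hBne : ((B 0).image (· + t 0)).Nonempty := by
    rw [Finset.image_nonempty]; exact Finset.card_pos.1 (by rw [(hc 0).2.1]; norm_num)
  have hCne : ((C 0).image (· + t 0)).Nonempty := by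
    rw [Finset.image_nonempty]; exact Finset.card_pos.1 (by rw [(hc 0).2.2]; norm_num)
  obtain ⟨b₀, hb₀⟩ := hBne
  obtain ⟨c₀, hc₀⟩ := hCne
  have hS'' := hS'.shiftBC (-b₀) (-c₀)
  refine ⟨_, _, _, hS'', ?_, ?_, ?_, ?_⟩
  · intro i
    refine ⟨?_, ?_, ?_⟩
    · rw [card_image_add_right]; exact (hc i).1
    · rw [card_image_add_right, card_image_add_right]; exact (hc i).2.1
    · rw [card_image_add_right, card_image_add_right]; exact (hc i).2.2
  · intro i
    exact Finset.mem_image.2 ⟨a i, ha i, by simp [t]⟩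
  · exact Finset.mem_image.2 ⟨b₀, hb₀, by simp⟩
  · exact Finset.mem_image.2 ⟨c₀, hc₀, by simp⟩

/-- **Stage 2 (an element of `GL₃(𝔽_p)`):** keeping (N1), (N2), reach (N3)–(N5) — by `IsSTPP.map_addEquiv` with the explicit shears. -/
theorem stage2 {A B C : Fin (k + 1) → Finset (V p)} (hS : IsSTPP A B C) (hc : Cards2 A B C)
    (hA : ∀ i, (0 : V p) ∈ A i) (hB : (0 : V p) ∈ B 0) (hC : (0 : V p) ∈ C 0) :
    ∃ A₂ B₂ C₂ : Fin (k + 1) → Finset (V p), IsSTPP A₂ B₂ C₂ ∧ Cards2 A₂ B₂ C₂ ∧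
      (∀ i, (0 : V p) ∈ A₂ i) ∧ (0 : V p) ∈ B₂ 0 ∧ (0 : V p) ∈ C₂ 0 ∧ A₂ 0 = {0, e1} ∧
      (∃ b c : V p, B₂ 0 = {0, b} ∧ C₂ 0 = {0, c} ∧
        ((InLine b ∧ (InLine c ∨ c = e2)) ∨ (b = e2 ∧ (InPlane c ∨ c = e3)))) := by
  classical
  obtain ⟨a, ha0, hAa⟩ := eq_pair_of_card_two (hc 0).1 (hA 0)
  obtain ⟨b, -, hBb⟩ := eq_pair_of_card_two (hc 0).2.1 hB
  obtain ⟨c, -, hCc⟩ := eq_pair_of_card_two (hc 0).2.2 hC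
  -- φ₁ : a ↦ e₁
  obtain ⟨φ₁, h1a⟩ := exists_map_eq_e1 a ha0
  -- φ₂ : fixes e₁, normalises b₁ := φ₁ b
  have hφ₂ : ∃ φ₂ : V p ≃+ V p, φ₂ e1 = e1 ∧ (InLine (φ₂ (φ₁ b)) ∨ φ₂ (φ₁ b) = e2) := by
    by_cases hb : InLine (φ₁ b)
    · exact ⟨AddEquiv.refl _, rfl, Or.inl hb⟩
    · obtain ⟨φ₂, h21, h2b⟩ := exists_fix_e1_map_eq_e2 (φ₁ b) hb
      exact ⟨φ₂, h21, Or.inr h2b⟩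
  obtain ⟨φ₂, h21, h2b⟩ := hφ₂
  -- φ₃ : fixes e₁ (and e₂ in the second case), normalises c₂ := φ₂ (φ₁ c)
  have hφ₃ : ∃ φ₃ : V p ≃+ V p, φ₃ e1 = e1 ∧
      ((InLine (φ₂ (φ₁ b)) ∧ φ₃ (φ₂ (φ₁ b)) = φ₂ (φ₁ b) ∧ (InLine (φ₃ (φ₂ (φ₁ c))) ∨ φ₃ (φ₂ (φ₁ c)) = e2)) ∨
       (φ₂ (φ₁ b) = e2 ∧ φ₃ e2 = e2 ∧ (InPlane (φ₃ (φ₂ (φ₁ c))) ∨ φ₃ (φ₂ (φ₁ c)) = e3))) := by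
    rcases h2b with hbl | hbe
    · by_cases hcl : InLine (φ₂ (φ₁ c))
      · exact ⟨AddEquiv.refl _, rfl, Or.inl ⟨hbl, rfl, Or.inl hcl⟩⟩
      · obtain ⟨φ₃, h31, h3c⟩ := exists_fix_e1_map_eq_e2 _ hcl
        exact ⟨φ₃, h31, Or.inl ⟨hbl, apply_eq_self_of_inLine φ₃ h31 hbl, Or.inr h3c⟩⟩
    · by_cases hcp : InPlane (φ₂ (φ₁ c))
      · exact ⟨AddEquiv.refl _, rfl, Or.inr ⟨hbe, rfl, Or.inl hcp⟩⟩
      · obtain ⟨φ₃, h31, h32, h3c⟩ := exists_fix_e1_e2_map_eq_e3 _ hcp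
        exact ⟨φ₃, h31, Or.inr ⟨hbe, h32, Or.inr h3c⟩⟩
  obtain ⟨φ₃, h31, h3⟩ := hφ₃
  let φ : V p ≃+ V p := (φ₁.trans φ₂).trans φ₃
  have hφa : φ a = e1 := by
    show φ₃ (φ₂ (φ₁ a)) = e1; rw [h1a, h21, h31]
  have hS' := hS.map_addEquiv φ
  refine ⟨_, _, _, hS', ?_, ?_, ?_, ?_, ?_, ?_⟩
  · intro i
    exact ⟨by rw [card_image_addEquiv]; exact (hc i).1, by rw [card_image_addEquiv]; exact (hc i).2.1,
      by rw [card_image_addEquiv]; exact (hc i).2.2⟩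
  · intro i; exact Finset.mem_image.2 ⟨0, hA i, map_zero φ⟩
  · exact Finset.mem_image.2 ⟨0, hB, map_zero φ⟩
  · exact Finset.mem_image.2 ⟨0, hC, map_zero φ⟩
  · show (A 0).image φ = {0, e1}
    rw [hAa, image_pair, map_zero, hφa]
  · refine ⟨φ b, φ c, ?_, ?_, ?_⟩
    · show (B 0).image φ = {0, φ b}; rw [hBb, image_pair, map_zero]
    · show (C 0).image φ = {0, φ c}; rw [hCc, image_pair, map_zero]
    · show (InLine (φ₃ (φ₂ (φ₁ b))) ∧ (InLine (φ₃ (φ₂ (φ₁ c))) ∨ φ₃ (φ₂ (φ₁ c)) = e2)) ∨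
        (φ₃ (φ₂ (φ₁ b)) = e2 ∧ (InPlane (φ₃ (φ₂ (φ₁ c))) ∨ φ₃ (φ₂ (φ₁ c)) = e3))
      rcases h3 with ⟨hbl, hfix, hcase⟩ | ⟨hbe, h32, hcase⟩
      · left; rw [hfix]; exact ⟨hbl, hcase⟩
      · right; rw [hbe, h32]; exact ⟨rfl, hcase⟩

/-- Translating the pair `{0, q}` by `−q` gives `{0, −q}`. -/
theorem image_pair_zero_neg (q : V p) : ({0, q} : Finset (V p)).image (· + -q) = {0, -q} := by
  rw [image_pair, zero_add, add_neg_cancel, Finset.pair_comm]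

/-- **Stage 3 (sign-min by per-member translations):** keeping everything at index `0` and (N1), reach (N6). -/
theorem stage3 {A B C : Fin (k + 1) → Finset (V p)} (hS : IsSTPP A B C) (hc : Cards2 A B C)
    (hA : ∀ i, (0 : V p) ∈ A i) :
    ∃ A₃ : Fin (k + 1) → Finset (V p), ∃ B₃ C₃ : Fin (k + 1) → Finset (V p), IsSTPP A₃ B₃ C₃ ∧ Cards2 A₃ B₃ C₃ ∧
      (∀ i, (0 : V p) ∈ A₃ i) ∧ A₃ 0 = A 0 ∧ B₃ 0 = B 0 ∧ C₃ 0 = C 0 ∧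
      ∃ q : Fin (k + 1) → V p, ∀ i, i ≠ 0 → A₃ i = {0, q i} ∧ code (q i) ≤ code (-(q i)) := by
  classical
  -- the nonzero element of each A i
  have hq : ∀ i, ∃ q : V p, q ≠ 0 ∧ A i = {0, q} := fun i => eq_pair_of_card_two (hc i).1 (hA i)
  choose q hq0 hAq using hq
  -- translation: flip the sign where the code of −q is smaller (never at index 0)
  let t : Fin (k + 1) → V p := fun i => if i ≠ 0 ∧ code (-(q i)) < code (q i) then -(q i) else 0
  have ht0 : t 0 = 0 := by simp [t]
  have hS' := hS.translate t
  have himg0 : ∀ s : Finset (V p), s.image (· + (0 : V p)) = s := fun s => by simp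
  refine ⟨fun i => (A i).image (· + t i), fun i => (B i).image (· + t i), fun i => (C i).image (· + t i), hS', ?_, ?_, ?_, ?_, ?_, ?_⟩
  · intro i
    exact ⟨by rw [card_image_add_right]; exact (hc i).1, by rw [card_image_add_right]; exact (hc i).2.1,
      by rw [card_image_add_right]; exact (hc i).2.2⟩
  · intro i
    show (0 : V p) ∈ (A i).image (· + t i)
    by_cases h : i ≠ 0 ∧ code (-(q i)) < code (q i)
    · have : t i = -(q i) := by simp [t, h]
      rw [this, hAq i, image_pair_zero_neg]; simp
    · have : t i = 0 := by simp [t, h]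
      rw [this, himg0]; exact hA i
  · show (A 0).image (· + t 0) = A 0; rw [ht0, himg0]
  · show (B 0).image (· + t 0) = B 0; rw [ht0, himg0]
  · show (C 0).image (· + t 0) = C 0; rw [ht0, himg0]
  · refine ⟨fun i => if i ≠ 0 ∧ code (-(q i)) < code (q i) then -(q i) else q i, fun i hi => ?_⟩
    by_cases h : code (-(q i)) < code (q i)
    · have hti : t i = -(q i) := by simp [t, hi, h]
      refine ⟨?_, ?_⟩
      · show (A i).image (· + t i) = {0, if i ≠ 0 ∧ code (-(q i)) < code (q i) then -(q i) else q i}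
        rw [hti, hAq i, image_pair_zero_neg]; simp [hi, h]
      · simp only [hi, h, and_self, if_true, neg_neg, ne_eq, not_false_eq_true]; exact le_of_lt h
    · have hti : t i = 0 := by simp [t, h]
      refine ⟨?_, ?_⟩
      · show (A i).image (· + t i) = {0, if i ≠ 0 ∧ code (-(q i)) < code (q i) then -(q i) else q i}
        rw [hti, himg0, hAq i]; simp [h]
      · simp only [h, and_false, if_false]; exact not_lt.mp h

/-- The re-indexing map of Stage 4: `0 ↦ 0`, `m+1 ↦ σ(m)+1`. -/
def liftPerm (σ : Equiv.Perm (Fin k)) : Fin (k + 1) → Fin (k + 1) := Fin.cases 0 fun m => (σ m).succ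

/-- `liftPerm σ 0 = 0`. -/
theorem liftPerm_zero (σ : Equiv.Perm (Fin k)) : liftPerm σ 0 = 0 := rfl

/-- `liftPerm σ (m+1) = σ(m)+1`. -/
theorem liftPerm_succ (σ : Equiv.Perm (Fin k)) (m : Fin k) : liftPerm σ m.succ = (σ m).succ := rfl

/-- `liftPerm σ` is injective. -/
theorem liftPerm_injective (σ : Equiv.Perm (Fin k)) : Function.Injective (liftPerm σ) := by
  intro i j hij
  cases i using Fin.cases with
  | zero =>
    cases j using Fin.cases with
    | zero => rfl
    | succ m' => rw [liftPerm_zero, liftPerm_succ] at hij; exact absurd hij.symm (Fin.succ_ne_zero _)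
  | succ m =>
    cases j using Fin.cases with
    | zero => rw [liftPerm_zero, liftPerm_succ] at hij; exact absurd hij (Fin.succ_ne_zero _)
    | succ m' => rw [liftPerm_succ, liftPerm_succ] at hij; rw [σ.injective (Fin.succ_injective _ hij)]

/-- `liftPerm σ` maps nonzero indices to nonzero indices. -/
theorem liftPerm_ne_zero (σ : Equiv.Perm (Fin k)) {i : Fin (k + 1)} (hi : i ≠ 0) : liftPerm σ i ≠ 0 := by
  intro h; apply hi; rw [← liftPerm_zero σ] at h; exact liftPerm_injective σ h

/-- **Stage 4 (sorting the triples `1 … k` by the code of `q`):** by `IsSTPP.comp_of_injective` with a lifted sorting permutation. -/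
theorem stage4 {A B C : Fin (k + 1) → Finset (V p)} (hS : IsSTPP A B C) (hc : Cards2 A B C)
    (hA : ∀ i, (0 : V p) ∈ A i) (q : Fin (k + 1) → V p) (hAq : ∀ i, i ≠ 0 → A i = {0, q i} ∧ code (q i) ≤ code (-(q i))) :
    ∃ ι : Fin (k + 1) → Fin (k + 1), Function.Injective ι ∧ ι 0 = 0 ∧ (∀ i, i ≠ 0 → ι i ≠ 0) ∧
      IsSTPP (fun i => A (ι i)) (fun i => B (ι i)) (fun i => C (ι i)) ∧ Cards2 (fun i => A (ι i)) (fun i => B (ι i)) (fun i => C (ι i)) ∧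
      (∀ i, (0 : V p) ∈ A (ι i)) ∧
      (∀ i, i ≠ 0 → A (ι i) = {0, q (ι i)} ∧ code (q (ι i)) ≤ code (-(q (ι i)))) ∧
      ∀ i j : Fin (k + 1), i ≠ 0 → i ≤ j → code (q (ι i)) ≤ code (q (ι j)) := by
  let f : Fin k → ℕ := fun m => code (q m.succ)
  let σ : Equiv.Perm (Fin k) := Tuple.sort f
  have hmono : Monotone (f ∘ σ) := Tuple.monotone_sort f
  refine ⟨liftPerm σ, liftPerm_injective σ, rfl, fun i hi => liftPerm_ne_zero σ hi, hS.comp_of_injective _ (liftPerm_injective σ),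
    fun i => hc _, fun i => hA _, fun i hi => hAq _ (liftPerm_ne_zero σ hi), ?_⟩
  intro i j hi hij
  cases i using Fin.cases with
  | zero => exact absurd rfl hi
  | succ m =>
    cases j using Fin.cases with
    | zero => exact absurd hij (not_le.mpr (Fin.succ_pos m))
    | succ m' =>
      rw [liftPerm_succ, liftPerm_succ]
      exact hmono (Fin.succ_le_succ_iff.mp hij)

/-- **THE WLOG THEOREM.** Every STPP family of `k+1` triples of 2-subsets of `ℤ/p × ℤ/p × ℤ/p` can be replaced by one IN 'gl' NORMAL FORM (N1)–(N7) — so a complete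
search (or an UNSAT certificate) restricted to normal-form families decides the existence of ANY such family. -/
theorem exists_glNormalForm {A B C : Fin (k + 1) → Finset (V p)} (hS : IsSTPP A B C) (hc : Cards2 A B C) :
    ∃ A' B' C' : Fin (k + 1) → Finset (V p), IsSTPP A' B' C' ∧ Cards2 A' B' C' ∧ GLNormalForm A' B' C' := by
  obtain ⟨A₁, B₁, C₁, hS₁, hc₁, hA₁, hB₁, hC₁⟩ := stage1 hS hc
  obtain ⟨A₂, B₂, C₂, hS₂, hc₂, hA₂, hB₂, hC₂, hA₂0, b, c, hB₂0, hC₂0, hbc⟩ := stage2 hS₁ hc₁ hA₁ hB₁ hC₁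
  obtain ⟨A₃, B₃, C₃, hS₃, hc₃, hA₃, hA₃0, hB₃0, hC₃0, q, hq⟩ := stage3 hS₂ hc₂ hA₂
  obtain ⟨ι, hι, hι0, hιne, hS₄, hc₄, hA₄, hq₄, hsort⟩ := stage4 hS₃ hc₃ hA₃ q hq
  refine ⟨_, _, _, hS₄, hc₄, hA₄, ?_, ?_, ?_, ?_, ?_⟩
  · show (0 : V p) ∈ B₃ (ι 0); rw [hι0, hB₃0]; exact hB₂
  · show (0 : V p) ∈ C₃ (ι 0); rw [hι0, hC₃0]; exact hC₂
  · show A₃ (ι 0) = {0, e1}; rw [hι0, hA₃0]; exact hA₂0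
  · refine ⟨b, c, ?_, ?_, hbc⟩
    · show B₃ (ι 0) = {0, b}; rw [hι0, hB₃0]; exact hB₂0
    · show C₃ (ι 0) = {0, c}; rw [hι0, hC₃0]; exact hC₂0
  · exact ⟨fun i => q (ι i), hq₄, hsort⟩

/-- **Corollary (the form the census uses):** if NO normal-form family of `k+1` triples of 2-sets exists, then `(ℤ/p)³` hosts no `(2,2,2)^{k+1}` STPP family at all. -/
theorem no_family_of_no_normalForm
    (h : ∀ A B C : Fin (k + 1) → Finset (V p), Cards2 A B C → GLNormalForm A B C → ¬ IsSTPP A B C) :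
    ¬ ∃ A B C : Fin (k + 1) → Finset (V p), IsSTPP A B C ∧ Cards2 A B C := by
  rintro ⟨A, B, C, hS, hc⟩
  obtain ⟨A', B', C', hS', hc', hnf⟩ := exists_glNormalForm hS hc
  exact h A' B' C' hc' hnf hS'

end NormalForm

end GLNF

end Summit.MatrixMultiplication.OmegaCensus
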